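import Literature.NumberTheory.Automorphic.ArchKirillovMirabolicRep
import Literature.NumberTheory.Automorphic.ArchGardingDerivationCalculus
import Literature.NumberTheory.Automorphic.ArchWhittakerCharNondegenerate
import HarnessLib

/-!
# The Kirillov function `u ↦ ℓ(τ(diag(u,1)) v)` of a Gårding vector of `GL₂(K_∞)`: continuity and `P₂`-covariance

Topic `NumberTheory/Automorphic`; namespace `Literature.NumberTheory.Automorphic`. Definitions with
bodies and theorems (no named fact). For a strongly continuous representation `τ` of `GL₂(K_∞)` on a
Banach space, a linear functional `ℓ` on its Gårding space `𝒢` and `v ∈ 𝒢`, the **Kirillov function**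
`kirillovFn hτ ℓ v : K_∞ˣ → ℂ`, `u ↦ ℓ(τ(a(u)) v)`, `a(u) = diag(u, 1)` (Jacquet–Shalika (1981), §3,
(3.16): `W(p)`, `p ∈ N \ P ≅ K_∞ˣ`). We PROVE:

* `IsGardingContComb` — bookkeeping notion: a map `T → E` that is a finite sum `Σ_i g_i(t) • e_i` of
  fixed Gårding vectors with continuous scalar coefficients; closed under the letters `τ(X_t)` with
  continuously varying `X_t` (`IsGardingContComb.apply_archDerivE`, expansion in a real basis of `M₂(K_∞)`)
  and under words (`isGardingContComb_archWordDerivE_map`);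
* `continuous_archWordDerivE_apply_toArch_diag` — `u ↦ τ(w) τ(a(u)) v` is continuous
  (`τ(w) τ(g) v = τ(g) τ(Ad(g⁻¹) w) v`);
* `continuous_kirillovFn` — **`W_v` is continuous** when `ℓ` is bounded by finitely many
  `U(𝔤)`-seminorms (e.g. a continuous Whittaker functional);
* `diagGL2_mul_mirabolic` — `a(u) p = n(u p₀₁) a(u p₀₀)` for `p` in the mirabolic `P₂`;
* `kirillovFn_toArch_mirabolic` — **`P₂`-covariance**: for a continuous `ψ_∞`-Whittaker functional,
  `W_{τ(p) v}(u) = ψ_∞(u p₀₁) W_v(u p₀₀)`, i.e. `W_{τ(p)v} = ρ(p) W_v` for the Kirillov representation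
  `ρ = kirillovRep` (`ArchKirillovMirabolicRep`).

These are the pointwise inputs of the closability route to
`Literature.NumberTheory.Automorphic.JacquetShalika1981_archKirillovNorm_le 1 K`.

## References

* H. Jacquet, J. A. Shalika, *On Euler products and the classification of automorphic
  representations I*, Amer. J. Math. 103 (1981), §3, (3.5), (3.16) [JacquetShalikaAJM1981].
-/

noncomputable section

open MeasureTheory Measure NumberField NumberField.mixedEmbedding NumberField.InfinitePlace IsDedekindDomain Set Filter
  Complex
open scoped MatrixGroups ENNReal NNReal Classical Topology ComplexConjugate Real

namespace Literature.NumberTheory.Automorphic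

variable {K : Type} [Field K] [NumberField K]

attribute [local instance] glInfBorel borelSpace_glInf locallyCompactSpace_glInf secondCountableTopology_glInf

-- as in `ArchGardingWhittaker`
set_option backward.isDefEq.respectTransparency false

/-! ### 1. Finite continuous combinations of Gårding vectors -/

section Comb

variable {n : ℕ} {hcpt : isCompact_glFiniteIntegralLevel n K}
  {E : Type*} [NormedAddCommGroup E] [NormedSpace ℂ E] [CompleteSpace E]
  {τ : ContRepresentation ℂ (AutomorphyDatum.gl n K hcpt).arch.carrier E}
  {T : Type*} [TopologicalSpace T]

variable (hcpt τ) in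
/-- `F : T → E` is a **finite continuous combination of Gårding vectors**: `F t = Σ_i g_i(t) • e_i` with
finitely many fixed `e_i ∈ 𝒢` and continuous `g_i : T → ℂ`. [folklore] -/
def IsGardingContComb (F : T → E) : Prop :=
  ∃ (ι : Type) (_ : Fintype ι) (g : ι → T → ℂ) (e : ι → E),
    (∀ i, Continuous (g i)) ∧ (∀ i, e i ∈ archGardingSpace hcpt τ) ∧ ∀ t, F t = ∑ i, g i t • e i

omit [CompleteSpace E] in
/-- A finite continuous combination is continuous. [folklore] -/
theorem IsGardingContComb.continuous {F : T → E} (hF : IsGardingContComb hcpt τ F) : Continuous F := by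
  obtain ⟨ι, _, g, e, hg, -, hF⟩ := hF
  have : F = fun t => ∑ i, g i t • e i := funext hF
  rw [this]
  exact continuous_finsetSum _ fun i _ => (hg i).smul continuous_const

omit [CompleteSpace E] in
/-- A finite continuous combination takes values in the Gårding space. [folklore] -/
theorem IsGardingContComb.mem {F : T → E} (hF : IsGardingContComb hcpt τ F) (t : T) : F t ∈ archGardingSpace hcpt τ := by
  obtain ⟨ι, _, g, e, -, he, hF⟩ := hF
  rw [hF t]
  exact Submodule.sum_mem _ fun i _ => Submodule.smul_mem _ _ (he i)

omit [CompleteSpace E] in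
/-- Constant Gårding vectors are finite continuous combinations. [folklore] -/
theorem isGardingContComb_const {v : E} (hv : v ∈ archGardingSpace hcpt τ) : IsGardingContComb hcpt τ (fun _ : T => v) :=
  ⟨Unit, inferInstance, fun _ _ => 1, fun _ => v, fun _ => continuous_const, fun _ => hv, fun t => by simp⟩

omit [CompleteSpace E] in
/-- `τ(X) 0 = 0`. [folklore] -/
theorem archDerivE_zero_vec (X : Matrix (Fin n) (Fin n) (mixedSpace K)) : archDerivE hcpt τ X (0 : E) = 0 := by
  unfold archDerivE
  simp only [map_zero]
  exact deriv_const 0 (0 : E)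

/-- `τ(X)` of a finite combination of Gårding vectors. [folklore] -/
theorem archDerivE_sum_smul_vec (hτ : τ.IsStronglyContinuous) (X : Matrix (Fin n) (Fin n) (mixedSpace K))
    {ι : Type*} (s : Finset ι) (c : ι → ℂ) {e : ι → E} (he : ∀ i, e i ∈ archGardingSpace hcpt τ) :
    archDerivE hcpt τ X (∑ i ∈ s, c i • e i) = ∑ i ∈ s, c i • archDerivE hcpt τ X (e i) := by
  classical
  induction s using Finset.induction_on with
  | empty => rw [Finset.sum_empty, Finset.sum_empty, archDerivE_zero_vec]
  | insert a s ha ih =>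
    rw [Finset.sum_insert ha, Finset.sum_insert ha, ← ih]
    have h1 : c a • e a ∈ archGardingSpace hcpt τ := Submodule.smul_mem _ _ (he a)
    have h2 : ∑ i ∈ s, c i • e i ∈ archGardingSpace hcpt τ := Submodule.sum_mem _ fun i _ => Submodule.smul_mem _ _ (he i)
    have hadd := archWordDerivE_add hτ h1 h2 [X]
    have hsmul := archWordDerivE_smul hτ (c a) (he a) [X]
    simp only [archWordDerivE_cons, archWordDerivE_nil] at hadd hsmul
    rw [hadd, hsmul]

/-- **Closure under letters**: if `F` is a finite continuous combination of Gårding vectors and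
`t ↦ X_t ∈ M_n(K_∞)` is continuous, then so is `t ↦ τ(X_t) (F t)` (expand `X_t` in a real basis of
`M_n(K_∞)`; the coordinates are continuous). [folklore] -/
theorem IsGardingContComb.apply_archDerivE (hτ : τ.IsStronglyContinuous) {F : T → E} (hF : IsGardingContComb hcpt τ F)
    {X : T → Matrix (Fin n) (Fin n) (mixedSpace K)} (hX : Continuous X) :
    IsGardingContComb hcpt τ (fun t => archDerivE hcpt τ (X t) (F t)) := by
  obtain ⟨ι, _, g, e, hg, he, hF⟩ := hF
  set b := Module.finBasis ℝ (Matrix (Fin n) (Fin n) (mixedSpace K)) with hb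
  refine ⟨ι × Fin (Module.finrank ℝ (Matrix (Fin n) (Fin n) (mixedSpace K))), inferInstance,
    fun p t => g p.1 t * ((b.coord p.2 (X t) : ℝ) : ℂ), fun p => archDerivE hcpt τ (b p.2) (e p.1),
    fun p => (hg p.1).mul (Complex.continuous_ofReal.comp (((b.coord p.2).continuous_of_finiteDimensional).comp hX)),
    fun p => archDerivE_mem_archGardingSpace hτ _ (he p.1), fun t => ?_⟩
  simp only
  rw [hF t, archDerivE_sum_smul_vec hτ (X t) Finset.univ (fun i => g i t) he, Fintype.sum_prod_type]
  refine Finset.sum_congr rfl fun i _ => ?_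
  have hXt : X t = ∑ j, b.coord j (X t) • b j := by
    conv_lhs => rw [← b.sum_repr (X t)]
    rfl
  conv_lhs => rw [hXt]
  rw [archDerivE_sum_smul_dir hτ (he i), Finset.smul_sum]
  refine Finset.sum_congr rfl fun j _ => ?_
  rw [smul_smul]

/-- **Closure under words with continuously varying letters.** [folklore] -/
theorem isGardingContComb_archWordDerivE_map (hτ : τ.IsStronglyContinuous) {v : E} (hv : v ∈ archGardingSpace hcpt τ) :
    ∀ ws : List (T → Matrix (Fin n) (Fin n) (mixedSpace K)), (∀ Xf ∈ ws, Continuous Xf) →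
      IsGardingContComb hcpt τ (fun t => archWordDerivE hcpt τ (ws.map fun Xf => Xf t) v)
  | [], _ => by simpa using isGardingContComb_const (T := T) hv
  | Xf :: ws, h => by
    have ih := isGardingContComb_archWordDerivE_map hτ hv ws fun Yf hY => h Yf (List.mem_cons_of_mem _ hY)
    simpa only [List.map_cons, archWordDerivE_cons] using ih.apply_archDerivE hτ (h Xf List.mem_cons_self)

/-- **Closure under words, starting from a family**: if `x` is a finite continuous combination of
Gårding vectors and the letters vary continuously, so is `t ↦ τ(w_t) (x t)`. [folklore] -/
theorem IsGardingContComb.archWordDerivE_map (hτ : τ.IsStronglyContinuous) {x : T → E} (hx : IsGardingContComb hcpt τ x) :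
    ∀ ws : List (T → Matrix (Fin n) (Fin n) (mixedSpace K)), (∀ Xf ∈ ws, Continuous Xf) →
      IsGardingContComb hcpt τ (fun t => archWordDerivE hcpt τ (ws.map fun Xf => Xf t) (x t))
  | [], _ => by simpa using hx
  | Xf :: ws, h => by
    have ih := IsGardingContComb.archWordDerivE_map hτ hx ws fun Yf hY => h Yf (List.mem_cons_of_mem _ hY)
    simpa only [List.map_cons, archWordDerivE_cons] using ih.apply_archDerivE hτ (h Xf List.mem_cons_self)

omit [CompleteSpace E] in
/-- **Scaling a family**: `t ↦ c(t) • x t` keeps the property. [folklore] -/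
theorem IsGardingContComb.smul {x : T → E} (hx : IsGardingContComb hcpt τ x) {c : T → ℂ} (hc : Continuous c) :
    IsGardingContComb hcpt τ (fun t => c t • x t) := by
  obtain ⟨ι, _, g, e, hg, he, hF⟩ := hx
  refine ⟨ι, inferInstance, fun i t => c t * g i t, e, fun i => hc.mul (hg i), he, fun t => ?_⟩
  change c t • x t = _
  rw [hF t, Finset.smul_sum]
  exact Finset.sum_congr rfl fun i _ => by rw [smul_smul]

omit [NumberField K] in
/-- `Ad(g⁻¹)` then `Ad(g)` is the identity on words. [folklore] -/
theorem map_adInv_map_ad_eq_self (g : GL (Fin n) (mixedSpace K)) (w : List (Matrix (Fin n) (Fin n) (mixedSpace K))) :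
    (w.map fun X => ((g⁻¹ : GL (Fin n) (mixedSpace K)) : Matrix (Fin n) (Fin n) (mixedSpace K)) * X *
        (g : Matrix (Fin n) (Fin n) (mixedSpace K))).map
      (fun X => (g : Matrix (Fin n) (Fin n) (mixedSpace K)) * X * ((g⁻¹ : GL (Fin n) (mixedSpace K)) : Matrix (Fin n) (Fin n) (mixedSpace K))) = w := by
  rw [List.map_map]
  conv_rhs => rw [← List.map_id w]
  refine List.map_congr_left fun X _ => ?_
  simp only [Function.comp_apply, id_eq]
  rw [← mul_assoc, ← mul_assoc, ← Units.val_mul, mul_inv_cancel, Units.val_one, one_mul, mul_assoc, ← Units.val_mul,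
    mul_inv_cancel, Units.val_one, mul_one]

/-- **`τ(w) τ(g) v = τ(g) τ(Ad(g⁻¹) w) v`** for Gårding `v`. [folklore] -/
theorem archWordDerivE_apply_toArch (hτ : τ.IsStronglyContinuous) (g : GL (Fin n) (mixedSpace K)) {v : E}
    (hv : v ∈ archGardingSpace hcpt τ) (w : List (Matrix (Fin n) (Fin n) (mixedSpace K))) :
    archWordDerivE hcpt τ w (τ (toArch hcpt g) v) =
      τ (toArch hcpt g) (archWordDerivE hcpt τ (w.map fun X => ((g⁻¹ : GL (Fin n) (mixedSpace K)) : Matrix (Fin n) (Fin n) (mixedSpace K)) * X *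
        (g : Matrix (Fin n) (Fin n) (mixedSpace K))) v) := by
  rw [apply_toArch_archWordDerivE hτ g hv, map_adInv_map_ad_eq_self]

/-- **`t ↦ τ(w) τ(g_t) v` is continuous** for Gårding `v` and a continuous family `g_t ∈ GL_n(K_∞)`.
[folklore] -/
theorem continuous_archWordDerivE_apply_toArch (hτ : τ.IsStronglyContinuous) {v : E} (hv : v ∈ archGardingSpace hcpt τ)
    {γ : T → GL (Fin n) (mixedSpace K)} (hγ : Continuous γ) (w : List (Matrix (Fin n) (Fin n) (mixedSpace K))) :
    Continuous fun t => archWordDerivE hcpt τ w (τ (toArch hcpt (γ t)) v) := by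
  have hcoe : Continuous fun t => ((γ t : GL (Fin n) (mixedSpace K)) : Matrix (Fin n) (Fin n) (mixedSpace K)) :=
    Units.continuous_val.comp hγ
  have hinv : Continuous fun t => (((γ t)⁻¹ : GL (Fin n) (mixedSpace K)) : Matrix (Fin n) (Fin n) (mixedSpace K)) :=
    Units.continuous_coe_inv.comp hγ
  -- the letters `Ad(γ_t⁻¹) X` vary continuously
  set ws : List (T → Matrix (Fin n) (Fin n) (mixedSpace K)) :=
    w.map fun X => fun t => (((γ t)⁻¹ : GL (Fin n) (mixedSpace K)) : Matrix (Fin n) (Fin n) (mixedSpace K)) * X *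
      ((γ t : GL (Fin n) (mixedSpace K)) : Matrix (Fin n) (Fin n) (mixedSpace K)) with hws
  have hws_cont : ∀ Xf ∈ ws, Continuous Xf := by
    intro Xf hXf
    obtain ⟨X, -, rfl⟩ := List.mem_map.1 hXf
    exact (hinv.mul continuous_const).mul hcoe
  obtain ⟨ι, _, g, e, hg, -, hF⟩ := isGardingContComb_archWordDerivE_map hτ hv ws hws_cont
  have heq : (fun t => archWordDerivE hcpt τ w (τ (toArch hcpt (γ t)) v)) = fun t => ∑ i, g i t • τ (toArch hcpt (γ t)) (e i) := by
    funext t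
    rw [archWordDerivE_apply_toArch hτ (γ t) hv w]
    have hmap : (w.map fun X => (((γ t)⁻¹ : GL (Fin n) (mixedSpace K)) : Matrix (Fin n) (Fin n) (mixedSpace K)) * X *
        ((γ t : GL (Fin n) (mixedSpace K)) : Matrix (Fin n) (Fin n) (mixedSpace K))) = ws.map fun Xf => Xf t := by
      rw [hws, List.map_map]
      rfl
    have hFt := hF t
    simp only at hFt
    rw [hmap, hFt, _root_.map_sum]
    simp only [map_smul]
  rw [heq]
  exact continuous_finsetSum _ fun i _ => (hg i).smul ((continuous_apply_toArch hcpt τ hτ (e i)).comp hγ)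

end Comb

/-! ### 2. The Kirillov function -/

section Kirillov

variable {hcpt : isCompact_glFiniteIntegralLevel 2 K}
  {E : Type*} [NormedAddCommGroup E] [NormedSpace ℂ E] [CompleteSpace E]
  {τ : ContRepresentation ℂ (AutomorphyDatum.gl 2 K hcpt).arch.carrier E}

/-- **The Kirillov function** `W_v(u) = ℓ(τ(a(u)) v)`, `a(u) = diag(u, 1)`, of a Gårding vector `v`
(Jacquet–Shalika (1981), (3.16): the Whittaker function on `N \ P ≅ K_∞ˣ`). [cite: JacquetShalikaAJM1981, §3, (3.16)] -/
def kirillovFn (hτ : τ.IsStronglyContinuous) (ℓ : archGardingSpace hcpt τ →ₗ[ℂ] ℂ) (v : archGardingSpace hcpt τ)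
    (u : (mixedSpace K)ˣ) : ℂ :=
  ℓ ⟨τ (toArch hcpt (diagGL2 u 1)) v, apply_mem_archGardingSpace hτ _ v.2⟩

/-- Unfolding of `kirillovFn`. [folklore] -/
theorem kirillovFn_apply (hτ : τ.IsStronglyContinuous) (ℓ : archGardingSpace hcpt τ →ₗ[ℂ] ℂ) (v : archGardingSpace hcpt τ)
    (u : (mixedSpace K)ˣ) :
    kirillovFn hτ ℓ v u = ℓ ⟨τ (toArch hcpt (diagGL2 u 1)) v, apply_mem_archGardingSpace hτ _ v.2⟩ := rfl

/-- `W_{v + v'} = W_v + W_{v'}`. [folklore] -/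
theorem kirillovFn_add (hτ : τ.IsStronglyContinuous) (ℓ : archGardingSpace hcpt τ →ₗ[ℂ] ℂ) (v v' : archGardingSpace hcpt τ) :
    kirillovFn hτ ℓ (v + v') = kirillovFn hτ ℓ v + kirillovFn hτ ℓ v' := by
  funext u
  rw [Pi.add_apply, kirillovFn_apply, kirillovFn_apply, kirillovFn_apply, ← map_add]
  congr 1
  exact Subtype.ext (by simp)

/-- `W_{c v} = c W_v`. [folklore] -/
theorem kirillovFn_smul (hτ : τ.IsStronglyContinuous) (ℓ : archGardingSpace hcpt τ →ₗ[ℂ] ℂ) (c : ℂ) (v : archGardingSpace hcpt τ) :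
    kirillovFn hτ ℓ (c • v) = c • kirillovFn hτ ℓ v := by
  funext u
  rw [Pi.smul_apply, kirillovFn_apply, kirillovFn_apply, smul_eq_mul, ← smul_eq_mul, ← map_smul]
  congr 1
  exact Subtype.ext (by simp)

omit [NumberField K] in
/-- `y ↦ diag(y, 1)` is continuous on `K_∞ˣ` (as in `KirillovL2BoundArch`). [folklore] -/
private theorem continuous_diagGL2_one' : Continuous fun y : (mixedSpace K)ˣ => (diagGL2 y 1 : GL (Fin 2) (mixedSpace K)) := by
  refine Units.continuous_iff.2 ⟨?_, ?_⟩
  · have h : (Units.val ∘ fun y : (mixedSpace K)ˣ => (diagGL2 y 1 : GL (Fin 2) (mixedSpace K))) =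
        fun y : (mixedSpace K)ˣ => !![((y : (mixedSpace K)ˣ) : mixedSpace K), 0; 0, ((1 : (mixedSpace K)ˣ) : mixedSpace K)] := by
      funext y; exact coe_diagGL2 y 1
    change Continuous (Units.val ∘ fun y : (mixedSpace K)ˣ => (diagGL2 y 1 : GL (Fin 2) (mixedSpace K)))
    rw [h]
    refine continuous_matrix fun i j => ?_
    fin_cases i <;> fin_cases j
    · exact Units.continuous_val
    · exact continuous_const
    · exact continuous_const
    · exact continuous_const
  · have h : (fun y : (mixedSpace K)ˣ => ((diagGL2 y 1 : GL (Fin 2) (mixedSpace K))⁻¹ : GL (Fin 2) (mixedSpace K)).val) =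
        fun y : (mixedSpace K)ˣ => !![((y⁻¹ : (mixedSpace K)ˣ) : mixedSpace K), 0; 0, ((1 : (mixedSpace K)ˣ) : mixedSpace K)] := by
      funext y
      rw [diagGL2_inv, inv_one]
      exact coe_diagGL2 y⁻¹ 1
    rw [h]
    refine continuous_matrix fun i j => ?_
    fin_cases i <;> fin_cases j
    · exact Units.continuous_coe_inv
    · exact continuous_const
    · exact continuous_const
    · exact continuous_const

/-- **The Kirillov function of a Gårding vector is continuous** when `ℓ` is bounded by finitely many
`U(𝔤)`-seminorms: `|W_v(u) - W_v(u₀)| ≤ C Σ_w ‖τ(w) τ(a(u)) v - τ(w) τ(a(u₀)) v‖` and each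
`u ↦ τ(w) τ(a(u)) v` is continuous. [cite: JacquetShalikaAJM1981, §3, (3.16)] -/
theorem continuous_kirillovFn (hτ : τ.IsStronglyContinuous) {ℓ : archGardingSpace hcpt τ →ₗ[ℂ] ℂ}
    (hℓ : ∃ (C : ℝ) (𝒮 : Finset (List (Matrix (Fin 2) (Fin 2) (mixedSpace K)))), 0 ≤ C ∧
      ∀ v : archGardingSpace hcpt τ, ‖ℓ v‖ ≤ C * ∑ w ∈ 𝒮, ‖archWordDerivE hcpt τ w v‖)
    (v : archGardingSpace hcpt τ) : Continuous (kirillovFn hτ ℓ v) := by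
  obtain ⟨C, 𝒮, hC, hbound⟩ := hℓ
  set G : List (Matrix (Fin 2) (Fin 2) (mixedSpace K)) → (mixedSpace K)ˣ → E :=
    fun w u => archWordDerivE hcpt τ w (τ (toArch hcpt (diagGL2 u 1)) v) with hG
  have hGc : ∀ w, Continuous (G w) := fun w =>
    continuous_archWordDerivE_apply_toArch hτ v.2 continuous_diagGL2_one' w
  refine continuous_iff_continuousAt.2 fun u₀ => ?_
  rw [ContinuousAt, tendsto_iff_norm_sub_tendsto_zero]
  have hlim : Tendsto (fun u => C * ∑ w ∈ 𝒮, ‖G w u - G w u₀‖) (𝓝 u₀) (𝓝 0) := by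
    have h : Tendsto (fun u => C * ∑ w ∈ 𝒮, ‖G w u - G w u₀‖) (𝓝 u₀) (𝓝 (C * ∑ w ∈ 𝒮, ‖G w u₀ - G w u₀‖)) :=
      (tendsto_finsetSum _ fun w _ => (((hGc w).sub continuous_const).norm).continuousAt).const_mul C
    simpa using h
  refine squeeze_zero (fun u => norm_nonneg _) (fun u => ?_) hlim
  -- `W_v(u) - W_v(u₀) = ℓ(τ(a(u)) v - τ(a(u₀)) v)`
  set x : archGardingSpace hcpt τ := ⟨τ (toArch hcpt (diagGL2 u 1)) v, apply_mem_archGardingSpace hτ _ v.2⟩ -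
    ⟨τ (toArch hcpt (diagGL2 u₀ 1)) v, apply_mem_archGardingSpace hτ _ v.2⟩ with hx
  have hdiff : kirillovFn hτ ℓ v u - kirillovFn hτ ℓ v u₀ = ℓ x := by
    rw [kirillovFn_apply, kirillovFn_apply, ← map_sub]
  rw [hdiff]
  refine (hbound x).trans (mul_le_mul_of_nonneg_left (Finset.sum_le_sum fun w _ => le_of_eq ?_) hC)
  -- `τ(w)` of the difference is the difference of the `G w`
  have h1 : (τ (toArch hcpt (diagGL2 u 1)) (v : E)) ∈ archGardingSpace hcpt τ := apply_mem_archGardingSpace hτ _ v.2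
  have h2 : (τ (toArch hcpt (diagGL2 u₀ 1)) (v : E)) ∈ archGardingSpace hcpt τ := apply_mem_archGardingSpace hτ _ v.2
  have hxE : (x : E) = τ (toArch hcpt (diagGL2 u 1)) (v : E) + (-1 : ℂ) • τ (toArch hcpt (diagGL2 u₀ 1)) (v : E) := by
    rw [hx, Submodule.coe_sub, neg_one_smul, sub_eq_add_neg]
  rw [hxE, archWordDerivE_add hτ h1 (Submodule.smul_mem _ _ h2) w, archWordDerivE_smul hτ (-1) h2 w, neg_one_smul, ← sub_eq_add_neg]

/-! ### 3. `P₂`-covariance -/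

omit [NumberField K] in
/-- **`a(u) p = n(u p₀₁) a(u p₀₀)`** for `p` in the mirabolic subgroup. [folklore] -/
theorem diagGL2_mul_mirabolic (u : (mixedSpace K)ˣ) (p : mirabolicTwo K) :
    diagGL2 u 1 * (p : GL (Fin 2) (mixedSpace K)) =
      ((unipotentGL2 ((u : mixedSpace K) * ((p : GL (Fin 2) (mixedSpace K)) : Matrix (Fin 2) (Fin 2) (mixedSpace K)) 0 1) :
        ↥(upperUnitriangular (Fin 2) (mixedSpace K))) : GL (Fin 2) (mixedSpace K)) * diagGL2 (u * mirabolicFst p) 1 := by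
  refine Units.ext ?_
  rw [Units.val_mul, Units.val_mul, coe_diagGL2, coe_diagGL2, coe_unipotentGL2]
  have h10 := p.2.1
  have h11 := p.2.2
  set P : Matrix (Fin 2) (Fin 2) (mixedSpace K) := ((p : GL (Fin 2) (mixedSpace K)) : Matrix (Fin 2) (Fin 2) (mixedSpace K)) with hP
  have hfst : ((mirabolicFst p : (mixedSpace K)ˣ) : mixedSpace K) = P 0 0 := coe_mirabolicFst p
  have hP' : P = !![P 0 0, P 0 1; P 1 0, P 1 1] := by
    refine Matrix.ext fun i j => ?_
    fin_cases i <;> fin_cases j <;> rfl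
  conv_lhs => rw [hP']
  rw [h10, h11, Units.val_mul, hfst, Units.val_one]
  refine Matrix.ext fun i j => ?_
  fin_cases i <;> fin_cases j <;> simp [Matrix.mul_apply, Fin.sum_univ_two]

/-- `ψ_∞(n(x)) = ψ_∞(1 · x) = archChar K 1 x`, and `archChar K u b = ψ_∞(n(u b))`. [folklore] -/
theorem archWhittakerChar_unipotentGL2 (x : mixedSpace K) :
    archWhittakerChar 2 K (unipotentGL2 x) = archChar K 1 x := by
  have hcoe : (((unipotentGL2 x : ↥(upperUnitriangular (Fin 2) (mixedSpace K))) : GL (Fin 2) (mixedSpace K)) :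
      Matrix (Fin 2) (Fin 2) (mixedSpace K)) = Matrix.transvection 0 1 x := by
    rw [coe_unipotentGL2, Matrix.transvection]
    refine Matrix.ext fun i j => ?_
    fin_cases i <;> fin_cases j <;> simp [Matrix.single]
  rw [archWhittakerChar_of_coe_eq_transvection (i := (0 : Fin 2)) (j := (1 : Fin 2)) K x (unipotentGL2 x) hcoe,
    if_pos (show ((0 : Fin 2) : ℕ) + 1 = ((1 : Fin 2) : ℕ) from rfl), archChar, archCharForm_apply, one_mul]

/-- **`P₂`-covariance of the Kirillov function**: for a continuous `ψ_∞`-Whittaker functional `ℓ`,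
`W_{τ(p) v}(u) = ψ_∞(u p₀₁) W_v(u p₀₀)` (`p` in the mirabolic subgroup), i.e. `W_{τ(p)v} = ρ(p) W_v`
for the Kirillov representation `ρ` of `ArchKirillovMirabolicRep`. [cite: JacquetShalikaAJM1981, §3, (3.5)–(3.6)] -/
theorem kirillovFn_toArch_mirabolic {hτ : τ.IsStronglyContinuous} {ℓ : archGardingSpace hcpt τ →ₗ[ℂ] ℂ}
    (hℓ : IsArchContWhittakerFunctional hcpt τ hτ ℓ) (p : mirabolicTwo K) (v : archGardingSpace hcpt τ) (u : (mixedSpace K)ˣ) :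
    kirillovFn hτ ℓ ⟨τ (toArch hcpt (p : GL (Fin 2) (mixedSpace K))) v, apply_mem_archGardingSpace hτ _ v.2⟩ u =
      archChar K (u : mixedSpace K) (((p : GL (Fin 2) (mixedSpace K)) : Matrix (Fin 2) (Fin 2) (mixedSpace K)) 0 1) *
        kirillovFn hτ ℓ v (u * mirabolicFst p) := by
  set b : mixedSpace K := ((p : GL (Fin 2) (mixedSpace K)) : Matrix (Fin 2) (Fin 2) (mixedSpace K)) 0 1 with hb
  set nu : ↥(upperUnitriangular (Fin 2) (mixedSpace K)) := unipotentGL2 ((u : mixedSpace K) * b) with hnu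
  rw [kirillovFn_apply, kirillovFn_apply]
  have hmul : τ (toArch hcpt (diagGL2 u 1)) (τ (toArch hcpt (p : GL (Fin 2) (mixedSpace K))) (v : E)) =
      τ (toArch hcpt (nu : GL (Fin 2) (mixedSpace K))) (τ (toArch hcpt (diagGL2 (u * mirabolicFst p) 1)) (v : E)) := by
    rw [← ContinuousLinearMap.comp_apply, ← ContinuousLinearMap.comp_apply]
    change (τ (toArch hcpt (diagGL2 u 1)) * τ (toArch hcpt (p : GL (Fin 2) (mixedSpace K)))) (v : E) =
      (τ (toArch hcpt (nu : GL (Fin 2) (mixedSpace K))) * τ (toArch hcpt (diagGL2 (u * mirabolicFst p) 1))) (v : E)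
    rw [← map_mul, ← map_mul]
    congr 2
    exact Subtype.ext (diagGL2_mul_mirabolic u p)
  have hmem := apply_mem_archGardingSpace hτ (toArch hcpt (diagGL2 (u * mirabolicFst p) 1)) v.2
  have key := hℓ.map_unipotent nu ⟨τ (toArch hcpt (diagGL2 (u * mirabolicFst p) 1)) (v : E), hmem⟩
  have hlhs : (⟨τ (toArch hcpt (diagGL2 u 1)) (τ (toArch hcpt (p : GL (Fin 2) (mixedSpace K))) (v : E)),
      apply_mem_archGardingSpace hτ _ (apply_mem_archGardingSpace hτ _ v.2)⟩ : archGardingSpace hcpt τ) =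
      ⟨τ (toArch hcpt (nu : GL (Fin 2) (mixedSpace K))) (τ (toArch hcpt (diagGL2 (u * mirabolicFst p) 1)) (v : E)),
        apply_mem_archGardingSpace hτ _ hmem⟩ := Subtype.ext hmul
  change ℓ ⟨τ (toArch hcpt (diagGL2 u 1)) (τ (toArch hcpt (p : GL (Fin 2) (mixedSpace K))) (v : E)), _⟩ = _
  rw [hlhs, key, hnu, archWhittakerChar_unipotentGL2, ← archChar_mul_left, one_mul]

end Kirillov

end Literature.NumberTheory.Automorphic
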